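import Summits.PneNP.PneNP.Theorems.KrwChromaticSteeringStrongCompositionLradDefs

/-!
# Crux line `lrad-gluing` (stmt-PneNP-18538), support statements S1–S3: row surgery and fibred realisability

Proofs (verbatim from the closed skeleton `Cruxes/StrongComposition/Lines/lrad_gluing.lean` §5, commit
5a5f8789ebd3) of the three support statements of the line over the objects of
`KrwChromaticSteeringStrongCompositionLradDefs.lean`:

* S1 `sat_setRow_of_touching` — ROW SURGERY: replacing row `i` of a solution of `E` by a row satisfying the
  row-`i` restriction of the equations TOUCHING row `i` keeps `E` satisfied (the other equations are invariant);
* S3 `perRowLUOfGeneric_holds : PerRowLUOfGeneric` — an `r`-affine-generic non-constant `g` is label-universal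
  with budget `n − r − 1` equations PER ROW (rows re-chosen one at a time by S1 inside the `≤ n − r − 1` touching
  equations, where genericity applies);
* S2 `exists_X_fibred`, `exists_X_fibred'` — FIBRED REALISABILITY: under per-row label-universality, a system
  with loads `≤ q` on row-set-free rows and arbitrary row-sets on equation-free rows realises every
  coordinatewise-realisable label column, with one equation-free row prescribed.

FRONTIER rung of the KRW programme; nothing here bears on P vs NP.
-/

set_option linter.dupNamespace false -- `Summit.PneNP.PneNP.…`: summit = sub-problem name (D-0017 single-conjunct layout)
set_option autoImplicit false

namespace Summit.PneNP.PneNP.Theorems.KrwLrad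

open Literature.Computability.Complexity

universe u

section PerRowBudget

variable {m n : ℕ}

/-- A row load is at most the number of equations. -/
theorem rowLoad_le_length (E : AffSys m n) (i : Fin m) : rowLoad E i ≤ E.length :=
  List.length_filter_le _ _

/-- The replaced row of `setRow X i y` is `y`. -/
@[simp] theorem row_setRow_same (X : Fin m × Fin n → Bool) (i : Fin m) (y : Fin n → Bool) :
    row (setRow X i y) i = y := by
  funext j; simp [row, setRow]

/-- `setRow` leaves the other rows unchanged. -/
theorem row_setRow_of_ne (X : Fin m × Fin n → Bool) {i i' : Fin m} (y : Fin n → Bool) (h : i' ≠ i) :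
    row (setRow X i y) i' = row X i' := by
  funext j; simp [row, setRow, h]

/-- [verbatim `P4g18.parityOn_setRow`] -/
theorem parityOn_setRow (S : Finset (Fin m × Fin n)) (X : Fin m × Fin n → Bool) (i : Fin m)
    (y : Fin n → Bool) :
    parityOn S (setRow X i y) = Bool.xor (rowParity (rowSupp S i) y) (parityOn (offRow S i) X) := by
  unfold parityOn rowParity
  have hsplit : S.filter (fun p => setRow X i y p = true)
      = (S.filter fun p => p.1 = i).filter (fun p => y p.2 = true)
        ∪ (offRow S i).filter (fun p => X p = true) := by
    ext p
    rcases p with ⟨i', j⟩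
    simp only [Finset.mem_filter, Finset.mem_union, offRow]
    by_cases h : i' = i
    · subst h; simp [setRow]
    · simp [setRow, h]
  have hdisj : Disjoint ((S.filter fun p => p.1 = i).filter (fun p => y p.2 = true))
      ((offRow S i).filter (fun p => X p = true)) := by
    rw [Finset.disjoint_left]
    intro p hp hq
    simp only [Finset.mem_filter, offRow] at hp hq
    exact hq.1.2 hp.1.2
  have hcard : ((S.filter fun p => p.1 = i).filter (fun p => y p.2 = true)).card
      = ((rowSupp S i).filter fun j => y j = true).card := by
    unfold rowSupp
    rw [Finset.filter_image, Finset.card_image_of_injOn]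
    rintro ⟨i₁, j₁⟩ hp ⟨i₂, j₂⟩ hq h
    simp only [Finset.coe_filter, Set.mem_setOf_eq, Finset.mem_filter] at hp hq
    simp only at h
    subst h
    rcases hp with ⟨⟨_, rfl⟩, _⟩
    rcases hq with ⟨⟨_, rfl⟩, _⟩
    rfl
  rw [hsplit, Finset.card_union_of_disjoint hdisj, Nat.bodd_add, hcard]

/-- An equation not touching row `i` has empty row-`i` support … -/
theorem rowSupp_eq_empty {S : Finset (Fin m × Fin n)} {i : Fin m} (h : i ∉ eqRows S) :
    rowSupp S i = ∅ := by
  unfold rowSupp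
  rw [Finset.image_eq_empty, Finset.filter_eq_empty_iff]
  intro p hp hpi
  exact h (Finset.mem_image.2 ⟨p, hp, hpi⟩)

/-- … and is its own off-row part. -/
theorem offRow_eq_self {S : Finset (Fin m × Fin n)} {i : Fin m} (h : i ∉ eqRows S) :
    offRow S i = S := by
  unfold offRow
  rw [Finset.filter_eq_self]
  intro p hp hpi
  exact h (Finset.mem_image.2 ⟨p, hp, hpi⟩)

/-- Parity on the empty support is `false`. -/
theorem rowParity_empty (y : Fin n → Bool) : rowParity (∅ : Finset (Fin n)) y = false := by
  simp [rowParity]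

/-- The number of equations touching row `i` is its load. -/
theorem length_touching (E : AffSys m n) (i : Fin m) : (touching E i).length = rowLoad E i := rfl

/-- Row surgery with the TOUCHING equations only: if `X ⊨ E` and `y` satisfies the row-`i` restriction
of the equations touching row `i`, then `setRow X i y ⊨ E`. -/
theorem sat_setRow_of_touching {E : AffSys m n} {X : Fin m × Fin n → Bool} (hX : Sat E X) (i : Fin m)
    {y : Fin n → Bool} (hy : ∀ e ∈ restrictRow (touching E i) i X, rowParity e.1 y = e.2) :
    Sat E (setRow X i y) := by
  intro e he
  rw [parityOn_setRow]
  by_cases ht : i ∈ eqRows e.1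
  · have hmem : (rowSupp e.1 i, Bool.xor e.2 (parityOn (offRow e.1 i) X))
        ∈ restrictRow (touching E i) i X := by
      simp only [restrictRow, touching, List.mem_map, List.mem_filter, decide_eq_true_eq]
      exact ⟨e, ⟨he, ht⟩, rfl⟩
    have h1 := hy _ hmem
    simp only at h1
    rw [h1]
    cases e.2 <;> cases parityOn (offRow e.1 i) X <;> rfl
  · rw [rowSupp_eq_empty ht, offRow_eq_self ht, rowParity_empty, hX e he]
    cases e.2 <;> rfl

/-- The current row satisfies its own restriction. -/
theorem restrictRow_row_self {E : AffSys m n} {X : Fin m × Fin n → Bool} (hX : Sat E X) (i : Fin m) :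
    ∀ e ∈ restrictRow (touching E i) i X, rowParity e.1 (row X i) = e.2 := by
  intro e' he'
  simp only [restrictRow, List.mem_map] at he'
  obtain ⟨e, he, rfl⟩ := he'
  have heE : e ∈ E := (List.mem_filter.1 he).1
  have h1 := hX e heE
  have h2 : parityOn e.1 (setRow X i (row X i)) = e.2 := by
    have : setRow X i (row X i) = X := by
      funext p
      rcases p with ⟨i', j⟩
      by_cases h : i' = i
      · subst h; simp [setRow, row]
      · simp [setRow, h]
    rw [this]; exact h1
  rw [parityOn_setRow] at h2
  simp only
  rw [← h2]
  cases rowParity (rowSupp e.1 i) (row X i) <;> cases parityOn (offRow e.1 i) X <;> rfl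

/-- **S3 holds**: per-row label-universality of an `r`-generic non-constant `g` with budget `n − r − 1`
equations PER ROW (for every number of rows). -/
theorem perRowLUOfGeneric_holds : PerRowLUOfGeneric := by
  intro m n r g hg hgen E hload hsat v
  obtain ⟨u, w, hu, hw⟩ := hg
  have key : ∀ k, k ≤ m → ∃ X, Sat E X ∧ ∀ i : Fin m, i.val < k → g (row X i) = v i := by
    intro k
    induction k with
    | zero =>
      intro _
      obtain ⟨X, hX⟩ := hsat
      exact ⟨X, hX, fun i hi => absurd hi (Nat.not_lt_zero _)⟩
    | succ k ih =>
      intro hk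
      obtain ⟨X, hX, hlab⟩ := ih (by omega)
      obtain ⟨i, hi⟩ : ∃ i : Fin m, i.val = k := ⟨⟨k, by omega⟩, rfl⟩
      -- a new row `y` with label `v i` satisfying the touching restriction
      have hy : ∃ y : Fin n → Bool,
          (∀ e ∈ restrictRow (touching E i) i X, rowParity e.1 y = e.2) ∧ g y = v i := by
        by_cases h0 : rowLoad E i = 0
        · -- no equation touches row `i`: any row will do
          have hnil : restrictRow (touching E i) i X = [] := by
            have : touching E i = [] := List.eq_nil_of_length_eq_zero (by rw [length_touching]; exact h0)
            simp [restrictRow, this]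
          cases hvi : v i
          · exact ⟨w, by simp [hnil], hw⟩
          · exact ⟨u, by simp [hnil], hu⟩
        · have hEi : (restrictRow (touching E i) i X).length + r + 1 ≤ n := by
            simp only [restrictRow, List.length_map, length_touching]
            have := hload i
            omega
          exact hgen _ hEi ⟨row X i, restrictRow_row_self hX i⟩ (v i)
      obtain ⟨y, hy, hgy⟩ := hy
      refine ⟨setRow X i y, sat_setRow_of_touching hX i hy, fun i' hi' => ?_⟩
      by_cases h : i' = i
      · subst h; simpa using hgy
      · rw [row_setRow_of_ne _ _ h]
        have : i'.val ≠ k := fun hh => h (Fin.ext (hh.trans hi.symm))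
        exact hlab i' (by omega)
  obtain ⟨X, hX, hlab⟩ := key m le_rfl
  exact ⟨X, hX, funext fun i => by simpa using hlab i i.isLt⟩

/-- Parities agree for matrices agreeing on the support. -/
theorem parityOn_congr {S : Finset (Fin m × Fin n)} {X X' : Fin m × Fin n → Bool}
    (h : ∀ p ∈ S, X p = X' p) : parityOn S X = parityOn S X' := by
  unfold parityOn
  rw [Finset.filter_congr (fun p hp => by rw [h p hp])]

/-- An equation of `E` touching row `i` gives it positive load. -/
theorem one_le_rowLoad_of_mem {E : AffSys m n} {e : Finset (Fin m × Fin n) × Bool} (he : e ∈ E)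
    {i : Fin m} (hi : i ∈ eqRows e.1) : 1 ≤ rowLoad E i := by
  unfold rowLoad
  exact List.length_pos_iff_exists_mem.2 ⟨e, List.mem_filter.2 ⟨he, by simpa using hi⟩⟩

/-- **S2 (fibred realisability).** -/
theorem exists_X_fibred {g : (Fin n → Bool) → Bool} {q : ℕ} (hLU : PerRowLU g m q) {E : AffSys m n}
    (hload : ∀ i, rowLoad E i ≤ q) (hsat : ∃ X, Sat E X) (S : Fin m → Set (Fin n → Bool))
    (htyped : ∀ i, rowLoad E i = 0 ∨ S i = Set.univ) {a : Fin m → Bool}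
    (ha : ∀ i, ∃ x ∈ S i, g x = a i) {i₀ : Fin m} (hi₀ : rowLoad E i₀ = 0) {x : Fin n → Bool}
    (hx : x ∈ S i₀) (hgx : g x = a i₀) :
    ∃ X, Sat E X ∧ rowLabels g X = a ∧ (∀ i, row X i ∈ S i) ∧ row X i₀ = x := by
  classical
  obtain ⟨X₀, hX₀, hlab₀⟩ := hLU E hload hsat a
  choose y hyS hyg using ha
  let y' : Fin m → Fin n → Bool := fun i => if i = i₀ then x else y i
  have hy'S : ∀ i, y' i ∈ S i := by
    intro i
    by_cases h : i = i₀
    · subst h; simpa [y'] using hx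
    · simpa [y', h] using hyS i
  have hy'g : ∀ i, g (y' i) = a i := by
    intro i
    by_cases h : i = i₀
    · subst h; simpa [y'] using hgx
    · simpa [y', h] using hyg i
  let X : Fin m × Fin n → Bool := fun p => if rowLoad E p.1 = 0 then y' p.1 p.2 else X₀ p
  have hrow0 : ∀ i, rowLoad E i = 0 → row X i = y' i := fun i h => funext fun j => by simp [X, h]
  have hrow1 : ∀ i, rowLoad E i ≠ 0 → row X i = row X₀ i := fun i h => funext fun j => by simp [X, h]
  refine ⟨X, ?_, ?_, ?_, ?_⟩
  · intro e he
    rw [← hX₀ e he]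
    apply parityOn_congr
    intro p hp
    have h1 : 1 ≤ rowLoad E p.1 := one_le_rowLoad_of_mem he (Finset.mem_image.2 ⟨p, hp, rfl⟩)
    have h1' : rowLoad E p.1 ≠ 0 := by omega
    simp [X, h1']
  · funext i
    rw [rowLabels_apply]
    by_cases h : rowLoad E i = 0
    · rw [hrow0 i h, hy'g]
    · rw [hrow1 i h, ← rowLabels_apply g X₀ i, hlab₀]
  · intro i
    rcases htyped i with h | h
    · rw [hrow0 i h]; exact hy'S i
    · rw [h]; exact Set.mem_univ _
  · rw [hrow0 i₀ hi₀]; simp [y']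

/-- S2 without a prescribed row (M3's `exists_X`, fibred); needs one untouched row only to instantiate the
prescribed-row version — stated here directly. -/
theorem exists_X_fibred' {g : (Fin n → Bool) → Bool} {q : ℕ} (hLU : PerRowLU g m q) {E : AffSys m n}
    (hload : ∀ i, rowLoad E i ≤ q) (hsat : ∃ X, Sat E X) (S : Fin m → Set (Fin n → Bool))
    (htyped : ∀ i, rowLoad E i = 0 ∨ S i = Set.univ) {a : Fin m → Bool}
    (ha : ∀ i, ∃ x ∈ S i, g x = a i) :
    ∃ X, Sat E X ∧ rowLabels g X = a ∧ ∀ i, row X i ∈ S i := by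
  classical
  obtain ⟨X₀, hX₀, hlab₀⟩ := hLU E hload hsat a
  choose y hyS hyg using ha
  let X : Fin m × Fin n → Bool := fun p => if rowLoad E p.1 = 0 then y p.1 p.2 else X₀ p
  have hrow0 : ∀ i, rowLoad E i = 0 → row X i = y i := fun i h => funext fun j => by simp [X, h]
  have hrow1 : ∀ i, rowLoad E i ≠ 0 → row X i = row X₀ i := fun i h => funext fun j => by simp [X, h]
  refine ⟨X, ?_, ?_, ?_⟩
  · intro e he
    rw [← hX₀ e he]
    apply parityOn_congr
    intro p hp
    have h1 : 1 ≤ rowLoad E p.1 := one_le_rowLoad_of_mem he (Finset.mem_image.2 ⟨p, hp, rfl⟩)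
    have h1' : rowLoad E p.1 ≠ 0 := by omega
    simp [X, h1']
  · funext i
    rw [rowLabels_apply]
    by_cases h : rowLoad E i = 0
    · rw [hrow0 i h, hyg]
    · rw [hrow1 i h, ← rowLabels_apply g X₀ i, hlab₀]
  · intro i
    rcases htyped i with h | h
    · rw [hrow0 i h]; exact hyS i
    · rw [h]; exact Set.mem_univ _

end PerRowBudget

end Summit.PneNP.PneNP.Theorems.KrwLrad
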